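import Literature.NumberTheory.NumberFields.CMFieldTwoRankSqrtNegOneOnePrime
import Literature.NumberTheory.IwasawaTheory.ClassicalMuVanishesImaginaryQuadraticTwoProofs
import Literature.NumberTheory.IwasawaTheory.NarrowClassNumberOnePrimeTower
import Literature.NumberTheory.IwasawaTheory.ZpExtensionNormKernelOnePrime
import Literature.NumberTheory.IwasawaTheory.CyclotomicTwoTotallyRamifiedOddIndex
import Literature.NumberTheory.IwasawaTheory.Fukuda1994Thm1RankProofs
import HarnessLib

/-!
# THE TWO-LAYER HORIE–FUKUDA CRITERION: `μ₂ = 0` for the cyclotomic `ℤ₂`-extension of `E(√−1)`, `E` totally real of odd degree with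
# odd class number and ONE prime above `2`, from ONE equality of narrow defects `#(U⁺/U²)(E·ℚ_1) = #(U⁺/U²)(E)`

Topic `NumberTheory/IwasawaTheory` (namespace = path).  THEOREM-ONLY file (no definition, no named fact, no instance, no `sorry`), written
by the prover seat `bsd-2adic-k4-w1` GEN 9 (cell `bsd-2adic`; `--supports` stmt-BirchSwinnertonDyer-22615, the `Δ > 0` rows of the
additive census of K4 crux C1″, whose honest carrier of Coates–Sujatha's statement (A) at `2` is the totally imaginary `F = ℚ(P, √−1)` over
the TOTALLY REAL cubic point field `ℚ(P)` — a carrier with real places downstairs, where neither Iwasawa 1973 nor the Kida-lite ascent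
applies and `h(F)` is EVEN).

THE THEOREM (`classicalMuVanishes_sup_adjoin_of_card_totPosUnitsModSq_layer_one_eq`).  `E ⊆ ℚ̄` totally real of ODD degree, `h(E)` odd,
exactly one prime of `E` above `2`; `i² = −1`; `ℚ_1 = ℚ(√2)` the first layer of THE cyclotomic `ℤ₂`-extension of `ℚ`
(`CyclotomicZp.zpExtension 2`).  If **`#(U⁺/U²)(E ⊔ ℚ_1) = #(U⁺/U²)(E)`** (equal NARROW DEFECTS `ord₂ h⁺ − ord₂ h` at layers `0` and `1`
of `E`'s tower — unit-signature data, decidable from finitely many units) then `μ = 0` (growth form, `ClassicalMuVanishes`) for EVERY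
cyclotomic `ℤ₂`-extension of `F = E ⊔ ℚ⟮i⟯`.

PROOF (kernel).  The layers of `F·ℚ_∞` are the CM fields `B_n = (E ⊔ ℚ_n) ⊔ ℚ⟮i⟯` with `B_n⁺ ≅ A_n = E ⊔ ℚ_n` totally real; `h(A_n)` is odd
(Iwasawa 1956, kernel) and `A_n` has one prime above `2` (total ramification, kernel); `2^{n+1} ∣ e(Q|2)` on `B_n` (`√−1 ∈ B_0`, `ζ₈ ∈ B_1`)
while `2^{n+1} ∤ [A_n:ℚ] = 2ⁿ·odd`; so Horie 1994 Lemma 1 (ii) (tree `CMFieldTwoRankSqrtNegOneOnePrime`) gives **`#Cl(B_n)[2] = #(U⁺/U²)(A_n)`**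
for `n = 0, 1`, whence `rank₂ Cl(B_1) = rank₂ Cl(B_0)`.  Fukuda's index of `F·ℚ_∞/F` is `0` (tree `CyclotomicTwoTotallyRamifiedEighthRoot`), so
Fukuda 1994 Thm. 1 (2) (tree `fukuda1994_thm1_classGroupPRank_const_of_succ_eq_holds`) bounds the `2`-ranks: `μ = 0`.

* §1 `natCard_twoTorsion_classGroup_sup_adjoin_eq_card_totPosUnitsModSq` — the per-layer Horie identity for `A ⊔ ℚ⟮i⟯`, `A ⊆ ℚ̄` totally real.
* §2 the layer data of `E ⊔ ℚ_1` (totally real, odd `h`, one prime above `2`, degree `2[E:ℚ]`) and the main theorem.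

HONEST SCOPE.  Classical statements (no elliptic curve).  The equality of narrow defects is a HYPOTHESIS (a finite unit certificate per
field; it can fail — then the `2`-ranks jump and nothing is claimed).  BSD is not proved by any of this.

References: [Horie1994] §1 Lemma 1 (ii); [Fukuda1994] Thm. 1 (2), p. 264; [Washington1997] §13.1, Thm. 10.4, Prop. 13.22;
[Greenberg2001IwasawaPastPresent] Prop. 2.1; [Kida1982JFields] (shape of the narrow/wide transfer).
-/

set_option autoImplicit false

noncomputable section

open scoped NumberField IntermediateField
open NumberField NumberField.IsCMField IsDedekindDomain Field IntermediateField Module Polynomial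

namespace Literature.NumberTheory.IwasawaTheory

open Literature.NumberTheory.EllipticCurves Literature.NumberTheory.EllipticCurves.ZpExtension
  Literature.NumberTheory.GaloisRepresentations Literature.NumberTheory.NumberFields
  Literature.Geometry.Kaehler.ComplexTorus

/-! ## §1 Horie's identity for `B = A ⊔ ℚ⟮i⟯`, `A ⊆ ℚ̄` totally real with odd `h` and one prime above `2` -/

section Layer

variable {i : AlgebraicClosure ℚ}

/-- `i` is integral over `ℚ` (`i² = −1`). [folklore] -/
private theorem isIntegral_of_sq_eq_neg_one' (hi : i ^ 2 = -1) : IsIntegral ℚ i :=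
  ⟨X ^ 2 + 1, monic_X_pow_add_C _ two_ne_zero, by simp [hi]⟩

/-- `[ℚ⟮i⟯ : ℚ] = 2` for `i² = −1` (`i` is a primitive `4`-th root of unity, minimal polynomial `Φ₄`). [folklore]
[cite: Washington1997, Ch. 2 (`[ℚ(ζ_n):ℚ] = φ(n)`)] -/
theorem finrank_adjoin_of_sq_eq_neg_one (hi : i ^ 2 = -1) :
    Module.finrank ℚ ↥(ℚ⟮i⟯ : IntermediateField ℚ (AlgebraicClosure ℚ)) = 2 := by
  have h4 : IsPrimitiveRoot i 4 := by
    refine IsPrimitiveRoot.mk_of_lt i (by norm_num) (by rw [show (4 : ℕ) = 2 * 2 by rfl, pow_mul, hi]; norm_num) ?_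
    intro k hk hk4
    interval_cases k
    · rw [pow_one]; intro h1; rw [h1] at hi; norm_num at hi
    · rw [hi]; norm_num
    · rw [show (3 : ℕ) = 2 + 1 by rfl, pow_succ, hi]
      intro h; have : i = -1 := by linear_combination -h
      rw [this] at hi; norm_num at hi
  rw [adjoin.finrank (isIntegral_of_sq_eq_neg_one' hi), ← Polynomial.cyclotomic_eq_minpoly_rat h4 (by norm_num),
    Polynomial.natDegree_cyclotomic]
  decide

/-- A field with a real embedding has no square root of `−1`. [folklore] -/
private theorem sq_ne_neg_one_of_ringHom_real {L : Type*} [Field L] (σ : L →+* ℝ) (y : L) : y ^ 2 ≠ -1 := by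
  intro h
  have h1 : (σ y) ^ 2 = -1 := by rw [← map_pow, h, map_neg, map_one]
  nlinarith [sq_nonneg (σ y)]

variable (A : IntermediateField ℚ (AlgebraicClosure ℚ)) [FiniteDimensional ℚ A]

/-- `i ∉ A` for `A ⊆ ℚ̄` totally real. [folklore] -/
private theorem not_mem_of_sq_eq_neg_one_of_isTotallyReal [IsTotallyReal A] (hi : i ^ 2 = -1) : i ∉ A := by
  haveI : NumberField A := NumberField.mk
  obtain ⟨w₀⟩ := (inferInstance : Nonempty (InfinitePlace A))
  exact fun h => sq_ne_neg_one_of_ringHom_real (InfinitePlace.embedding_of_isReal (IsTotallyReal.isReal w₀)) ⟨i, h⟩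
    (Subtype.ext (by simp [hi]))

/-- **`[A ⊔ ℚ⟮i⟯ : ℚ] = 2·[A : ℚ]`** for `A ⊆ ℚ̄` totally real (`√−1 ∉ A`, `[ℚ(i):ℚ] = 2`). [cite: Washington1997, Ch. 2, Thm. 2.5 (`[ℚ(ζ_n):ℚ] = φ(n)`) and §13 (CM fields `K⁺(√−1)`)] -/
theorem finrank_sup_adjoin_of_isTotallyReal [IsTotallyReal A] (hi : i ^ 2 = -1) :
    Module.finrank ℚ ↥(A ⊔ ℚ⟮i⟯) = Module.finrank ℚ A * 2 := by
  haveI : FiniteDimensional ℚ ↥ℚ⟮i⟯ := adjoin.finiteDimensional (isIntegral_of_sq_eq_neg_one' hi)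
  have hAB : A ≤ A ⊔ ℚ⟮i⟯ := le_sup_left
  have hiB : i ∈ A ⊔ ℚ⟮i⟯ := (le_sup_right : ℚ⟮i⟯ ≤ A ⊔ ℚ⟮i⟯) (mem_adjoin_simple_self ℚ i)
  have hiA := not_mem_of_sq_eq_neg_one_of_isTotallyReal A hi
  have hlt : Module.finrank ℚ A < Module.finrank ℚ ↥(A ⊔ ℚ⟮i⟯) := by
    refine lt_of_le_of_ne (finrank_le_of_le_right hAB) fun heq => hiA ?_
    rw [eq_of_le_of_finrank_eq hAB heq]; exact hiB
  have hle : Module.finrank ℚ ↥(A ⊔ ℚ⟮i⟯) ≤ Module.finrank ℚ A * 2 := by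
    have h := finrank_sup_le A ℚ⟮i⟯
    rwa [finrank_adjoin_of_sq_eq_neg_one hi] at h
  have hdvd : Module.finrank ℚ A ∣ Module.finrank ℚ ↥(A ⊔ ℚ⟮i⟯) := finrank_dvd_of_le_right hAB
  obtain ⟨m, hm⟩ := hdvd
  have hpos : 0 < Module.finrank ℚ A := Module.finrank_pos
  have hm2 : m = 2 := by
    rcases Nat.lt_or_ge m 2 with h | h
    · interval_cases m <;> [simp [hm] at hlt; (rw [hm, mul_one] at hlt; exact absurd hlt (lt_irrefl _))]
    · exact le_antisymm (by rw [hm] at hle; exact Nat.le_of_mul_le_mul_left hle hpos) h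
  rw [hm, hm2]

set_option maxHeartbeats 400000 in
/-- **Horie's identity for `B = A(√−1)`, `A ⊆ ℚ̄` totally real**: if `h(A)` is odd, `A` has exactly one prime above `2`, every prime
`Q ∣ 2` of `B = A ⊔ ℚ⟮i⟯` has `2^{k+1} ∣ e(Q|2)` and `2^{k+1} ∤ [A:ℚ]`, then `#Cl(B)[2] = #(U⁺/U²)(A)` (`B` is CM with `B⁺ ≅ A`; tree
`IsCMField.natCard_twoTorsion_classGroup_eq_card_totPosUnitsModSq_of_sq_eq_neg_one`, transported along `CMExtension.equivMaximalRealSubfield`).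
[cite: Horie1994, §1 Lemma 1 (ii)] [cite: Okazaki2000, §3 Lemma 17] -/
theorem natCard_twoTorsion_classGroup_sup_adjoin_eq_card_totPosUnitsModSq [IsTotallyReal A] (hi : i ^ 2 = -1)
    (hodd : haveI : NumberField A := NumberField.mk; Odd (classNumber A))
    (huniq : ∃! v : HeightOneSpectrum (𝓞 A), ((2 : ℕ) : 𝓞 A) ∈ v.asIdeal) (k : ℕ)
    (hup : haveI : FiniteDimensional ℚ ↥ℚ⟮i⟯ := adjoin.finiteDimensional (isIntegral_of_sq_eq_neg_one' hi)
      haveI : NumberField ↥(A ⊔ ℚ⟮i⟯) := NumberField.mk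
      ∀ (Q : Ideal (𝓞 ↥(A ⊔ ℚ⟮i⟯))) [Q.IsPrime] [Q.LiesOver (Ideal.span {(2 : ℤ)})], 2 ^ (k + 1) ∣ Q.ramificationIdx ℤ)
    (hdown : ¬ 2 ^ (k + 1) ∣ Module.finrank ℚ A) :
    (haveI : FiniteDimensional ℚ ↥ℚ⟮i⟯ := adjoin.finiteDimensional (isIntegral_of_sq_eq_neg_one' hi)
     haveI : NumberField ↥(A ⊔ ℚ⟮i⟯) := NumberField.mk
     Nat.card {c : ClassGroup (𝓞 ↥(A ⊔ ℚ⟮i⟯)) // c ^ 2 = 1}) =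
      (haveI : NumberField A := NumberField.mk; Nat.card (TotPosUnitsModSq A)) := by
  haveI : FiniteDimensional ℚ ↥ℚ⟮i⟯ := adjoin.finiteDimensional (isIntegral_of_sq_eq_neg_one' hi)
  haveI : NumberField A := NumberField.mk
  haveI : NumberField ↥(A ⊔ ℚ⟮i⟯) := NumberField.mk
  have hAB : A ≤ A ⊔ ℚ⟮i⟯ := le_sup_left
  have hiB : i ∈ A ⊔ ℚ⟮i⟯ := (le_sup_right : ℚ⟮i⟯ ≤ A ⊔ ℚ⟮i⟯) (mem_adjoin_simple_self ℚ i)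
  -- the relative structure `A → B`
  letI : Algebra A ↥(A ⊔ ℚ⟮i⟯) := (inclusion hAB).toRingHom.toAlgebra
  haveI : IsScalarTower ℚ A ↥(A ⊔ ℚ⟮i⟯) := IsScalarTower.of_algebraMap_eq fun q => ((inclusion hAB).commutes q).symm
  haveI : Module.Finite A ↥(A ⊔ ℚ⟮i⟯) := Module.Finite.of_restrictScalars_finite ℚ A _
  have hdeg : Module.finrank A ↥(A ⊔ ℚ⟮i⟯) = 2 := by
    have htower := Module.finrank_mul_finrank ℚ A ↥(A ⊔ ℚ⟮i⟯)
    rw [finrank_sup_adjoin_of_isTotallyReal A hi] at htower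
    exact Nat.eq_of_mul_eq_mul_left Module.finrank_pos htower
  haveI : Algebra.IsQuadraticExtension A ↥(A ⊔ ℚ⟮i⟯) := ⟨hdeg⟩
  haveI : IsTotallyComplex ↥(A ⊔ ℚ⟮i⟯) := by
    refine ⟨fun w => ?_⟩
    by_contra hw
    rw [InfinitePlace.not_isComplex_iff_isReal] at hw
    exact sq_ne_neg_one_of_ringHom_real (InfinitePlace.embedding_of_isReal hw) ⟨i, hiB⟩ (Subtype.ext (by simp [hi]))
  haveI : IsCMField ↥(A ⊔ ℚ⟮i⟯) := IsCMField.ofCMExtension A _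
  set e := CMExtension.equivMaximalRealSubfield A ↥(A ⊔ ℚ⟮i⟯) with he
  -- the integer `x = i ∈ 𝓞 B`, `x² = −1`
  have hyint : IsIntegral ℤ (⟨i, hiB⟩ : ↥(A ⊔ ℚ⟮i⟯)) :=
    ⟨X ^ 2 + 1, monic_X_pow_add_C _ two_ne_zero, by ext; simp [hi]⟩
  set x : 𝓞 ↥(A ⊔ ℚ⟮i⟯) := ⟨⟨i, hiB⟩, hyint⟩ with hx
  have hx2 : x ^ 2 = -1 := by ext; simp [hx, hi]
  -- finrank of `B⁺` is that of `A`
  have hfin : Module.finrank ℚ (maximalRealSubfield ↥(A ⊔ ℚ⟮i⟯)) = Module.finrank ℚ A := by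
    have h1 := Module.finrank_mul_finrank ℚ A ↥(A ⊔ ℚ⟮i⟯)
    have h2 := Module.finrank_mul_finrank ℚ (maximalRealSubfield ↥(A ⊔ ℚ⟮i⟯)) ↥(A ⊔ ℚ⟮i⟯)
    rw [hdeg] at h1
    rw [(IsCMField.isQuadraticExtension ↥(A ⊔ ℚ⟮i⟯)).finrank_eq_two] at h2
    omega
  have hres := IsCMField.natCard_twoTorsion_classGroup_eq_card_totPosUnitsModSq_of_sq_eq_neg_one ↥(A ⊔ ℚ⟮i⟯) hx2
    (odd_classNumber_of_ringEquiv e hodd) (existsUnique_natCast_mem_of_ringEquiv e 2 huniq) k hup (by rwa [hfin])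
  rw [hres.1, card_totPosUnitsModSq_eq_of_ringEquiv e]

end Layer

/-! ## §2 The layer `E ⊔ ℚ_1` and the main theorem -/

section Tower

variable (E : IntermediateField ℚ (AlgebraicClosure ℚ)) [FiniteDimensional ℚ E] [IsTotallyReal E]

omit [IsTotallyReal E] in
/-- The cyclotomic `ℤ₂`-extension of `ℚ` restricts ONTO `Γ_E` for `[E:ℚ]` odd. [cite: Washington1997, §13.1] -/
theorem surjective_comp_absGaloisRestrict_cyclotomicZp_of_odd (hE : Odd (Module.finrank ℚ E)) :
    haveI : NumberField E := NumberField.mk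
    Function.Surjective ((CyclotomicZp.zpExtension 2).toContinuousMonoidHom.comp (absGaloisRestrict ℚ E)) := by
  haveI : NumberField E := NumberField.mk
  exact surjective_comp_absGaloisRestrict_of_not_dvd_finrank _ E hE.not_two_dvd_nat

set_option synthInstance.maxHeartbeats 200000 in
/-- **The layer data of `A_n = E ⊔ ℚ_n`** (`ℚ_n` the `n`-th layer of the cyclotomic `ℤ₂`-extension of `ℚ`), for `E ⊆ ℚ̄` totally real of odd
degree with odd `h(E)` and exactly one prime above `2`: `A_n ≅ (E·ℚ_∞)_n` is totally real, `h(A_n)` is odd (Iwasawa 1956 / Washington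
10.4, kernel), `A_n` has exactly one prime above `2` (total ramification from layer `0`: odd `e(v|2)` below), and `[A_n : ℚ] = 2ⁿ[E:ℚ]`.
[cite: Washington1997, Thm. 10.4, §13.1 and Prop. 13.22] [cite: Greenberg2001IwasawaPastPresent, Prop. 2.1 p. 339] -/
theorem layer_data_sup_layer (hE : Odd (Module.finrank ℚ E)) (hh : haveI : NumberField E := NumberField.mk; Odd (classNumber E))
    (h2 : ∃! v : HeightOneSpectrum (𝓞 E), ((2 : ℕ) : 𝓞 E) ∈ v.asIdeal) (n : ℕ) :
    haveI : FiniteDimensional ℚ ↥((CyclotomicZp.zpExtension 2).layer n) := (CyclotomicZp.zpExtension 2).finiteDimensional_layer_holds n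
    haveI : NumberField ↥(E ⊔ (CyclotomicZp.zpExtension 2).layer n) := NumberField.mk
    IsTotallyReal ↥(E ⊔ (CyclotomicZp.zpExtension 2).layer n) ∧
      Odd (classNumber ↥(E ⊔ (CyclotomicZp.zpExtension 2).layer n)) ∧
      (∃! v : HeightOneSpectrum (𝓞 ↥(E ⊔ (CyclotomicZp.zpExtension 2).layer n)),
        ((2 : ℕ) : 𝓞 ↥(E ⊔ (CyclotomicZp.zpExtension 2).layer n)) ∈ v.asIdeal) ∧
      Module.finrank ℚ ↥(E ⊔ (CyclotomicZp.zpExtension 2).layer n) = Module.finrank ℚ E * 2 ^ n := by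
  set κ := CyclotomicZp.zpExtension 2 with hκdef
  haveI : FiniteDimensional ℚ ↥(κ.layer n) := κ.finiteDimensional_layer_holds n
  haveI : NumberField E := NumberField.mk
  haveI : NumberField ↥(E ⊔ κ.layer n) := NumberField.mk
  have hsurj := surjective_comp_absGaloisRestrict_cyclotomicZp_of_odd E hE
  set κE := κ.restrict E hsurj with hκE
  haveI : FiniteDimensional E (κE.layer n) := κE.finiteDimensional_layer_holds n
  haveI : NumberField (κE.layer n) := NumberField.of_module_finite E _
  -- `(E·ℚ_∞)_n ≅ E ⊔ ℚ_n`
  obtain ⟨f⟩ := nonempty_algEquiv_layer_restrict_fieldRange_sup_layer κ E hsurj E.val n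
  have hrange : E.val.fieldRange ⊔ κ.layer n = E ⊔ κ.layer n := by rw [fieldRange_val]
  set e : ↥(κE.layer n) ≃ₐ[ℚ] ↥(E ⊔ κ.layer n) := f.trans (equivOfEq hrange) with hedef
  -- odd `e(v|2)` in `E` (one prime, odd degree), hence total ramification from layer `0`
  have hodd_e : ∀ w : HeightOneSpectrum (𝓞 E), ((2 : ℕ) : 𝓞 E) ∈ w.asIdeal → Odd (w.asIdeal.ramificationIdx ℤ) :=
    fun w hw => Nat.odd_iff.mpr (Nat.two_dvd_ne_zero.mp fun h0 => hE.not_two_dvd_nat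
      (h0.trans (ramificationIdx_dvd_finrank_of_existsUnique_two_mem h2 w hw)))
  have htot : TotallyRamifiedFrom κE 0 :=
    totallyRamifiedFrom_zero_of_forall_odd_ramificationIdx hE.not_two_dvd_nat κE
      (isCyclotomic_restrict κ (CyclotomicZp.isCyclotomic_zpExtension 2) E hsurj) hodd_e
  haveI : IsTotallyReal ↥(κE.layer n) := isTotallyReal_layer κE n
  refine ⟨IsTotallyReal.ofRingEquiv e.toRingEquiv, ?_, ?_, ?_⟩
  · -- odd class number (Iwasawa 1956)
    have h := not_dvd_classNumber_layer_of_classNumberPExp_eq_zero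
      iwasawa1956_classNumberPExp_eq_zero_of_not_dvd_classNumber_of_unique_prime_holds hh.not_two_dvd_nat h2 κE n
    exact odd_classNumber_of_ringEquiv e.toRingEquiv (Nat.odd_iff.mpr (Nat.two_dvd_ne_zero.mp h))
  · -- one prime above `2`
    obtain ⟨v₀, hv₀, hv₀u⟩ := h2
    obtain ⟨𝔓, h𝔓max, -, h𝔓u⟩ :=
      exists_ramificationIdx_eq_pow_of_totallyRamifiedFrom_zero κE n htot v₀ (fun w hw => hv₀u w hw)
    have h𝔓0 : 𝔓 ≠ ⊥ := Ring.ne_bot_of_isMaximal_of_not_isField h𝔓max (RingOfIntegers.not_isField _)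
    -- `2 ∈ 𝔓`: a prime above `v₀` exists and equals `𝔓`
    haveI : v₀.asIdeal.IsMaximal := v₀.isMaximal
    obtain ⟨Q, hQmax, hQover⟩ := Ideal.exists_maximal_ideal_liesOver_of_isIntegral (S := 𝓞 (κE.layer n)) v₀.asIdeal
    haveI := hQmax
    have hQ2 : ((2 : ℕ) : 𝓞 E) ∈ Q.under (𝓞 E) := by rw [← hQover.over]; exact hv₀
    have hQ𝔓 : Q = 𝔓 := h𝔓u Q hQ2
    have h2𝔓 : ((2 : ℕ) : 𝓞 (κE.layer n)) ∈ 𝔓 := by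
      rw [← hQ𝔓]
      have : algebraMap (𝓞 E) (𝓞 (κE.layer n)) ((2 : ℕ) : 𝓞 E) ∈ Q := by
        rw [← Ideal.mem_comap, ← Ideal.under_def]; exact hQ2
      rwa [map_natCast] at this
    have huK : ∃! v : HeightOneSpectrum (𝓞 (κE.layer n)), ((2 : ℕ) : 𝓞 (κE.layer n)) ∈ v.asIdeal := by
      refine ⟨⟨𝔓, h𝔓max.isPrime, h𝔓0⟩, h2𝔓, fun w hw => ?_⟩
      haveI := w.isPrime
      haveI : w.asIdeal.IsMaximal := w.isPrime.isMaximal w.ne_bot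
      have hw' : ((2 : ℕ) : 𝓞 E) ∈ w.asIdeal.under (𝓞 E) := by
        rw [Ideal.under_def, Ideal.mem_comap, map_natCast]; exact hw
      exact HeightOneSpectrum.ext (h𝔓u w.asIdeal hw')
    exact existsUnique_natCast_mem_of_ringEquiv e.toRingEquiv 2 huK
  · rw [← e.toLinearEquiv.finrank_eq, finrank_layer_restrict κ E hsurj n]

/-- **THE TWO-LAYER HORIE–FUKUDA CRITERION.**  `E ⊆ ℚ̄` totally real of ODD degree with `h(E)` odd and exactly one prime above `2`;
`i² = −1`; `ℚ_1` the first layer of the cyclotomic `ℤ₂`-extension of `ℚ` (`ℚ_1 = ℚ(√2)`).  If the narrow defects of `E` and `E ⊔ ℚ_1` agree,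
**`#(U⁺/U²)(E ⊔ ℚ_1) = #(U⁺/U²)(E)`**, then Iwasawa's `μ`-invariant vanishes (growth form) for EVERY cyclotomic `ℤ₂`-extension of
`F = E ⊔ ℚ⟮i⟯`.  Kernel: Horie's identity `#Cl(B_n)[2] = #(U⁺/U²)(A_n)` at the layers `B_0 ≅ F`, `B_1 ≅ F ⊔ ℚ_1` of `F·ℚ_∞` (§1, fed by
`layer_data_sup_layer`; `√−1 ∈ B_0`, `ζ₈ ∈ B_1`), so `rank₂ Cl(B_1) = rank₂ Cl(B_0)`; Fukuda's index is `0`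
(`totallyRamifiedFrom_zero_of_sq_eq_neg_one_of_existsUnique`); Fukuda 1994 Thm. 1 (2) (tree, kernel).
[cite: Horie1994, §1 Lemma 1 (ii)] [cite: Fukuda1994, Thm. 1 (2), p. 264] [cite: Washington1997, §13.1 and Prop. 13.22] -/
theorem classicalMuVanishes_sup_adjoin_of_card_totPosUnitsModSq_layer_one_eq (hE : Odd (Module.finrank ℚ E))
    (hh : haveI : NumberField E := NumberField.mk; Odd (classNumber E))
    (h2 : ∃! v : HeightOneSpectrum (𝓞 E), ((2 : ℕ) : 𝓞 E) ∈ v.asIdeal) {i : AlgebraicClosure ℚ} (hi : i ^ 2 = -1)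
    (hδ : haveI : FiniteDimensional ℚ ↥((CyclotomicZp.zpExtension 2).layer 1) :=
        (CyclotomicZp.zpExtension 2).finiteDimensional_layer_holds 1
      haveI : NumberField ↥(E ⊔ (CyclotomicZp.zpExtension 2).layer 1) := NumberField.mk
      haveI : NumberField E := NumberField.mk
      Nat.card (TotPosUnitsModSq ↥(E ⊔ (CyclotomicZp.zpExtension 2).layer 1)) = Nat.card (TotPosUnitsModSq E))
    (κF : ZpExtension ↥(E ⊔ ℚ⟮i⟯) 2) (hκF : κF.IsCyclotomic) :
    ClassicalMuVanishes κF := by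
  classical
  set κ := CyclotomicZp.zpExtension 2 with hκdef
  have hκ : κ.IsCyclotomic := CyclotomicZp.isCyclotomic_zpExtension 2
  haveI : FiniteDimensional ℚ ↥ℚ⟮i⟯ := adjoin.finiteDimensional (isIntegral_of_sq_eq_neg_one' hi)
  haveI : ∀ n, FiniteDimensional ℚ ↥(κ.layer n) := fun n => κ.finiteDimensional_layer_holds n
  haveI : NumberField E := NumberField.mk
  haveI : NumberField ↥(E ⊔ ℚ⟮i⟯) := NumberField.mk
  have hiF : i ∈ E ⊔ ℚ⟮i⟯ := (le_sup_right : ℚ⟮i⟯ ≤ E ⊔ ℚ⟮i⟯) (mem_adjoin_simple_self ℚ i)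
  have hxF : (⟨i, hiF⟩ : ↥(E ⊔ ℚ⟮i⟯)) ^ 2 = -1 := Subtype.ext (by simp [hi])
  have hF2 : Module.finrank ℚ ↥(E ⊔ ℚ⟮i⟯) = Module.finrank ℚ E * 2 := finrank_sup_adjoin_of_isTotallyReal E hi
  have h4 : ¬ 4 ∣ Module.finrank ℚ ↥(E ⊔ ℚ⟮i⟯) := by
    rw [hF2]
    intro h
    have h' : 2 * 2 ∣ Module.finrank ℚ E * 2 := by simpa [mul_comm] using h
    exact hE.not_two_dvd_nat (Nat.dvd_of_mul_dvd_mul_right two_pos h')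
  -- the restricted tower `F·ℚ_∞ / F`
  have hsurjF := surjective_comp_absGaloisRestrict_of_sq_eq_neg_one κ hκ hxF h4
  set κ' := κ.restrict ↥(E ⊔ ℚ⟮i⟯) hsurjF with hκ'
  have hκ'cyc : κ'.IsCyclotomic := isCyclotomic_restrict κ hκ ↥(E ⊔ ℚ⟮i⟯) hsurjF
  -- one prime above `2` in `F`, Fukuda's index `0`
  have hAB : E ≤ E ⊔ ℚ⟮i⟯ := le_sup_left
  letI : Algebra E ↥(E ⊔ ℚ⟮i⟯) := (inclusion hAB).toRingHom.toAlgebra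
  haveI : IsScalarTower ℚ E ↥(E ⊔ ℚ⟮i⟯) := IsScalarTower.of_algebraMap_eq fun q => ((inclusion hAB).commutes q).symm
  haveI : Module.Finite E ↥(E ⊔ ℚ⟮i⟯) := Module.Finite.of_restrictScalars_finite ℚ E _
  have hdegEF : Module.finrank E ↥(E ⊔ ℚ⟮i⟯) = 2 := by
    have htower := Module.finrank_mul_finrank ℚ E ↥(E ⊔ ℚ⟮i⟯)
    rw [hF2] at htower
    exact Nat.eq_of_mul_eq_mul_left Module.finrank_pos htower
  haveI : Algebra.IsQuadraticExtension E ↥(E ⊔ ℚ⟮i⟯) := ⟨hdegEF⟩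
  have hyint : IsIntegral ℤ (⟨i, hiF⟩ : ↥(E ⊔ ℚ⟮i⟯)) := ⟨X ^ 2 + 1, monic_X_pow_add_C _ two_ne_zero, by ext; simp [hi]⟩
  have hxF2 : (⟨⟨i, hiF⟩, hyint⟩ : 𝓞 ↥(E ⊔ ℚ⟮i⟯)) ^ 2 = -1 := by ext; simp [hi]
  have hodd_e : ∀ w : HeightOneSpectrum (𝓞 E), ((2 : ℕ) : 𝓞 E) ∈ w.asIdeal → Odd (w.asIdeal.ramificationIdx ℤ) :=
    fun w hw => Nat.odd_iff.mpr (Nat.two_dvd_ne_zero.mp fun h0 => hE.not_two_dvd_nat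
      (h0.trans (ramificationIdx_dvd_finrank_of_existsUnique_two_mem h2 w hw)))
  have hF1 : ∃! w : HeightOneSpectrum (𝓞 ↥(E ⊔ ℚ⟮i⟯)), ((2 : ℕ) : 𝓞 ↥(E ⊔ ℚ⟮i⟯)) ∈ w.asIdeal :=
    existsUnique_two_mem_of_sq_eq_neg_one hdegEF hxF2 h2 hodd_e
  have htot : TotallyRamifiedFrom κ' 0 := totallyRamifiedFrom_zero_of_sq_eq_neg_one_of_existsUnique hxF h4 hF1 κ' hκ'cyc
  -- the layers `B_n ≅ (E ⊔ ℚ_n) ⊔ ℚ⟮i⟯` and their `2`-ranks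
  have hrank : ∀ n, haveI : NumberField ↥((E ⊔ κ.layer n) ⊔ ℚ⟮i⟯) := NumberField.mk
      2 ^ classGroupPRank κ' n = Nat.card {c : ClassGroup (𝓞 ↥((E ⊔ κ.layer n) ⊔ ℚ⟮i⟯)) // c ^ 2 = 1} := by
    intro n
    haveI : NumberField ↥((E ⊔ κ.layer n) ⊔ ℚ⟮i⟯) := NumberField.mk
    obtain ⟨f⟩ := nonempty_algEquiv_layer_restrict_fieldRange_sup_layer κ ↥(E ⊔ ℚ⟮i⟯) hsurjF (E ⊔ ℚ⟮i⟯).val n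
    have hrange : (E ⊔ ℚ⟮i⟯).val.fieldRange ⊔ κ.layer n = (E ⊔ κ.layer n) ⊔ ℚ⟮i⟯ := by rw [fieldRange_val, sup_right_comm]
    rw [← natCard_torsion_classGroup_layer_eq κ' n]
    exact natCard_twoTorsion_classGroup_eq_of_ringEquiv (f.trans (equivOfEq hrange)).toRingEquiv
  -- Horie at the layers `n = 0` and `n = 1`
  have hlayer : ∀ n, n ≤ 1 →
      haveI : NumberField ↥((E ⊔ κ.layer n) ⊔ ℚ⟮i⟯) := NumberField.mk
      haveI : NumberField ↥(E ⊔ κ.layer n) := NumberField.mk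
      Nat.card {c : ClassGroup (𝓞 ↥((E ⊔ κ.layer n) ⊔ ℚ⟮i⟯)) // c ^ 2 = 1} = Nat.card (TotPosUnitsModSq ↥(E ⊔ κ.layer n)) := by
    intro n hn
    haveI : NumberField ↥(E ⊔ κ.layer n) := NumberField.mk
    haveI : NumberField ↥((E ⊔ κ.layer n) ⊔ ℚ⟮i⟯) := NumberField.mk
    obtain ⟨hreal, hoddn, huniqn, hfinn⟩ := layer_data_sup_layer E hE hh h2 n
    haveI := hreal
    have hiBn : i ∈ (E ⊔ κ.layer n) ⊔ ℚ⟮i⟯ := (le_sup_right : ℚ⟮i⟯ ≤ _) (mem_adjoin_simple_self ℚ i)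
    refine natCard_twoTorsion_classGroup_sup_adjoin_eq_card_totPosUnitsModSq (E ⊔ κ.layer n) hi hoddn huniqn n ?_ ?_
    · -- `2^{n+1} ∣ e(Q|2)` upstairs: `√−1` (`n = 0`), `ζ₈` (`n = 1`)
      intro Q _ _
      interval_cases n
      · have hyi : IsIntegral ℤ (⟨i, hiBn⟩ : ↥((E ⊔ κ.layer 0) ⊔ ℚ⟮i⟯)) :=
          ⟨X ^ 2 + 1, monic_X_pow_add_C _ two_ne_zero, by ext; simp [hi]⟩
        have hx0 : (⟨⟨i, hiBn⟩, hyi⟩ : 𝓞 ↥((E ⊔ κ.layer 0) ⊔ ℚ⟮i⟯)) ^ 2 = -1 := by ext; simp [hi]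
        simpa using (even_ramificationIdx_int_of_sq_eq_neg_one hx0 Q).two_dvd
      · obtain ⟨t, ht, ht2⟩ := CyclotomicZp.exists_mem_layer_one_sq_eq_two_zpExtension
        have htB : t ∈ (E ⊔ κ.layer 1) ⊔ ℚ⟮i⟯ := (le_sup_left : E ⊔ κ.layer 1 ≤ _) ((le_sup_right : κ.layer 1 ≤ _) ht)
        have hzB : (1 + i) * t / 2 ∈ (E ⊔ κ.layer 1) ⊔ ℚ⟮i⟯ :=
          div_mem (mul_mem (add_mem (one_mem _) hiBn) htB) (ofNat_mem _ 2)
        have hz4 : ((1 + i) * t / 2) ^ 4 = -1 := by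
          have : ((1 + i) * t / 2) ^ 4 = ((1 + i) ^ 2) ^ 2 * (t ^ 2) ^ 2 / 16 := by ring
          rw [this, ht2, show (1 + i) ^ 2 = 2 * i by linear_combination hi]
          linear_combination (1 : AlgebraicClosure ℚ) * hi
        have hzi : IsIntegral ℤ (⟨(1 + i) * t / 2, hzB⟩ : ↥((E ⊔ κ.layer 1) ⊔ ℚ⟮i⟯)) :=
          ⟨X ^ 4 + 1, monic_X_pow_add_C _ (by norm_num), by ext; simp [hz4]⟩
        have hz' : (⟨⟨(1 + i) * t / 2, hzB⟩, hzi⟩ : 𝓞 ↥((E ⊔ κ.layer 1) ⊔ ℚ⟮i⟯)) ^ 4 = -1 := by ext; simp [hz4]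
        simpa using four_dvd_ramificationIdx_int_of_pow_four_eq_neg_one hz' Q
    · rw [hfinn]
      interval_cases n
      · simpa using hE.not_two_dvd_nat
      · intro h
        have h' : 2 * 2 ∣ Module.finrank ℚ E * 2 := by simpa [pow_succ] using h
        exact hE.not_two_dvd_nat (Nat.dvd_of_mul_dvd_mul_right two_pos h')
  -- the two layers have the same `2`-rank
  have h01 : classGroupPRank κ' (0 + 1) = classGroupPRank κ' 0 := by
    apply Nat.pow_right_injective le_rfl
    simp only [zero_add]
    rw [hrank 1, hrank 0, hlayer 1 le_rfl, hlayer 0 (Nat.zero_le 1)]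
    -- layer `0`: `E ⊔ ℚ_0 = E`
    have h0 : E ⊔ κ.layer 0 = E := by
      rw [ZpExtension.layer_zero]; exact le_antisymm (sup_le le_rfl bot_le) le_sup_left
    haveI : NumberField ↥(E ⊔ κ.layer 1) := NumberField.mk
    haveI : NumberField ↥(E ⊔ κ.layer 0) := NumberField.mk
    haveI : IsTotallyReal ↥(E ⊔ κ.layer 0) := (layer_data_sup_layer E hE hh h2 0).1
    rw [hδ, card_totPosUnitsModSq_eq_of_ringEquiv (equivOfEq h0).toRingEquiv]
  have hμ : ClassicalMuVanishes κ' :=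
    classicalMuVanishes_of_classGroupPRank_succ_eq fukuda1994_thm1_classGroupPRank_const_of_succ_eq_holds κ' htot le_rfl h01
  exact (classicalMuVanishes_iff_of_isCyclotomic κF κ' hκF hκ'cyc).mpr hμ

end Tower

end Literature.NumberTheory.IwasawaTheory

end
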